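import Mathlib.NumberTheory.ModularForms.JacobiTheta.TwoVariable
import Mathlib.Analysis.SpecificLimits.Normed
import Mathlib.Analysis.SpecialFunctions.Complex.Log
import Mathlib.Algebra.Field.NegOnePow
import Mathlib.Algebra.Ring.Int.Parity
import Mathlib.Analysis.Normed.Field.Ultra
import Literature.Analysis.SpecialFunctions.JacobiThetaZeros
import HarnessLib

/-!
# [EtTh] §1, Proposition 1.4: the classical theta function of the Tate curve

Mochizuki, *The étale theta function and its Frobenioid-theoretic manifestations*, Publ. RIMS **45**
(2009) 227–349 [cite: MochizukiEtTh2009, Prop 1.4 p.21] (PRIMS PDF p. 21 = printed p. 247; kurims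
ms. p. 20). Layer L2 of the abc-iut cell, seat abc-iut-L2-t1; this is the ANALYTIC half of
Proposition 1.4, built on Mathlib and the tree's complex theta library, with no interface to the
tempered fundamental group (that half — the divisor of poles `D₁` on the special fibre and
part (iii), Kummer classes — is typed in `EtaleThetaClass.lean` over the tempered interface).

**The series.** Mochizuki sets (display of Prop. 1.4)
`Θ̈(Ü) := q_X^{-1/8} · Σ_{n ∈ ℤ} (-1)^n · q_X^{(1/2)(n+1/2)²} · Ü^{2n+1}`, a function on the double
cover `Ü² = U` of the multiplicative coordinate `U` of the Tate curve with `q`-parameter `q_X`.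
Since `-1/8 + (1/2)(n + 1/2)² = n(n+1)/2` (`exponent_bookkeeping` below) and `K̈ = K(q_X^{1/2})`
(p. 18: `K̈ := K₂ = K(ζ₂, q_X^{1/2})`), the series is, with `q̈ := q_X^{1/2}`,
`Θ̈(Ü) = Σ_{n ∈ ℤ} (-1)^n · q̈^{n(n+1)} · Ü^{2n+1}` — integral exponents only. We define it in this
form, `thetaDdot q̈ Ü`, over an arbitrary normed field `𝕜` (the paper: finite extensions of `ℚ_p`;
the definition and part (ii) are insensitive to the field).

**Contents (claims of Prop. 1.4 and its proof, p. 21–22).**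
* `thetaDdot`, `thetaDdotTerm`: the series and its general term; `exponent_bookkeeping`;
* PROVED, part (ii): `thetaDdot_inv` (`Θ̈(Ü⁻¹) = -Θ̈(Ü)`), `thetaDdot_neg` (`Θ̈(-Ü) = -Θ̈(Ü)`),
  `thetaDdot_zpow_mul` (`Θ̈(q̈^a Ü) = (-1)^a q̈^{-a²} Ü^{-2a} Θ̈(Ü)`, i.e. the printed
  `Θ̈(q_X^{a/2} Ü) = (-1)^a q_X^{-a²/2} Ü^{-2a} Θ̈(Ü)`) — by re-indexing the sum, valid with no
  convergence hypothesis;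
* PROVED, from the proof of (i): "a similar calculation shows that `Θ̈(±1) = 0`"
  (`thetaDdot_one`, `thetaDdot_neg_one`), hence `Θ̈(±q̈^a) = 0` for all `a ∈ ℤ`
  (`thetaDdot_zpow`, `thetaDdot_neg_zpow`) — the cusps of `Ÿ` are zeros;
* PROVED: convergence for `‖q̈‖ < 1` in a complete normed field (`summable_thetaDdotTerm`), the
  "`∈ Γ(Ü, O_Ü)`, so `Θ̈` extends to a meromorphic function" clause at the level of points;
* PROVED over `ℂ`: `thetaDdot_eq_jacobiTheta₂` (`Θ̈ = e^{πiz} · ϑ(z + (1+τ)/2, τ)` for `q̈ = e^{πiτ}`,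
  `Ü = e^{πiz}`: `Θ̈` is Jacobi's odd theta function) and the ZERO LOCUS of part (i),
  `thetaDdot_eq_zero_iff_complex`: `Θ̈(Ü) = 0 ↔ Ü = ±q̈^a` — via the tree's
  `jacobiTheta₂_eq_zero_iff` (Jacobi triple product);
* NAMED FACTS (not proved here): part (i) over complete NONARCHIMEDEAN fields — the zero locus
  `ThetaDdotZeroLocus` and simplicity of the zeros `ThetaDdotSimpleZeros` (classical Tate-curve
  theory, [Mumf] pp. 306–307 as cited on p. 21; needs the triple product over such fields, which the
  tree has over `ℂ` only).

Deliberately NOT here: the formal-scheme statements of (i) (divisor of poles `= D₁`), part (iii),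
and everything involving `Π^tp` — see `EtaleThetaClass.lean`. Nothing here is specific to the abc
programme and no statement of the paper is strengthened; HONEST FRAMING: this file takes no side on
any disputed claim (Prop. 1.4 is classical and undisputed).
-/

namespace Literature.AnabelianGeometry.EtaleTheta

open Filter
open scoped _root_.Topology

/-! ### The series, over any normed field -/

section General

variable {𝕜 : Type*} [NormedField 𝕜]

/-- The exponent bookkeeping behind our integral form of the series of Prop. 1.4:
`-1/8 + (1/2)(n + 1/2)² = n(n+1)/2`, so `q_X^{-1/8} q_X^{(1/2)(n+1/2)²} = (q_X^{1/2})^{n(n+1)}`.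
[cite: MochizukiEtTh2009, Prop 1.4 p.21] -/
theorem exponent_bookkeeping (n : ℚ) :
    -(1 / 8 : ℚ) + (1 / 2) * (n + 1 / 2) ^ 2 = n * (n + 1) / 2 := by
  ring

/-- The general term of Mochizuki's theta series in integral form:
`(-1)^n · q̈^{n(n+1)} · Ü^{2n+1}` (`q̈ = q_X^{1/2}`), `n ∈ ℤ`. [cite: MochizukiEtTh2009, Prop 1.4 p.21] -/
def thetaDdotTerm (q2 U : 𝕜) (n : ℤ) : 𝕜 :=
  ((n.negOnePow : ℤ) : 𝕜) * q2 ^ (n * (n + 1)) * U ^ (2 * n + 1)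

/-- **The classical theta function of the Tate curve** (Prop. 1.4, display):
`Θ̈(Ü) = q_X^{-1/8} Σ_{n ∈ ℤ} (-1)^n q_X^{(1/2)(n+1/2)²} Ü^{2n+1} = Σ_{n ∈ ℤ} (-1)^n q̈^{n(n+1)} Ü^{2n+1}`
with `q̈ = q_X^{1/2} ∈ K̈`, as a `tsum` (value `0` by convention where the series diverges).
[cite: MochizukiEtTh2009, Prop 1.4 p.21] -/
noncomputable def thetaDdot (q2 U : 𝕜) : 𝕜 :=
  ∑' n : ℤ, thetaDdotTerm q2 U n

/-- Re-indexing `n ↦ -(n+1)` exchanges `Ü` and `Ü⁻¹` up to sign: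
`T(q̈, Ü⁻¹, -(n+1)) = -T(q̈, Ü, n)` (the "routine calculation" behind `Θ̈(Ü) = -Θ̈(Ü⁻¹)`).
[cite: MochizukiEtTh2009, Prop 1.4 (ii) p.22] -/
theorem thetaDdotTerm_inv_neg_succ (q2 U : 𝕜) (n : ℤ) :
    thetaDdotTerm q2 U⁻¹ (-(n + 1)) = -thetaDdotTerm q2 U n := by
  have h1 : -(n + 1) * (-(n + 1) + 1) = n * (n + 1) := by ring
  have h2 : (2 : ℤ) * -(n + 1) + 1 = -(2 * n + 1) := by ring
  simp only [thetaDdotTerm, h1, h2, inv_zpow', neg_neg, Int.negOnePow_neg, Int.negOnePow_succ,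
    Units.val_neg, Int.cast_neg, neg_mul]

/-- `T(q̈, -Ü, n) = -T(q̈, Ü, n)` (odd powers of `Ü` only). [cite: MochizukiEtTh2009, Prop 1.4 (ii) p.22] -/
theorem thetaDdotTerm_neg (q2 U : 𝕜) (n : ℤ) :
    thetaDdotTerm q2 (-U) n = -thetaDdotTerm q2 U n := by
  have hodd : Odd (2 * n + 1) := odd_two_mul_add_one n
  simp only [thetaDdotTerm, hodd.neg_zpow, mul_neg]

/-- Re-indexing `n ↦ n - a` for the substitution `Ü ↦ q̈^a Ü`:
`T(q̈, q̈^a Ü, n - a) = (-1)^a q̈^{-a²} Ü^{-2a} · T(q̈, Ü, n)` (`q̈, Ü ≠ 0`).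
[cite: MochizukiEtTh2009, Prop 1.4 (ii) p.22] -/
theorem thetaDdotTerm_shift {q2 U : 𝕜} (hq : q2 ≠ 0) (hU : U ≠ 0) (a n : ℤ) :
    thetaDdotTerm q2 (q2 ^ a * U) (n - a) =
      ((a.negOnePow : ℤ) : 𝕜) * q2 ^ (-(a * a)) * U ^ (-(2 * a)) * thetaDdotTerm q2 U n := by
  have e1 : q2 ^ ((n - a) * (n - a + 1)) * q2 ^ (a * (2 * (n - a) + 1)) =
      q2 ^ (-(a * a)) * q2 ^ (n * (n + 1)) := by
    rw [← zpow_add₀ hq, ← zpow_add₀ hq]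
    congr 1
    ring
  have e2 : U ^ (2 * (n - a) + 1) = U ^ (-(2 * a)) * U ^ (2 * n + 1) := by
    rw [← zpow_add₀ hU]
    congr 1
    ring
  have e3 : (((n - a).negOnePow : ℤ) : 𝕜) = ((n.negOnePow : ℤ) : 𝕜) * ((a.negOnePow : ℤ) : 𝕜) := by
    rw [Int.negOnePow_sub, Units.val_mul, Int.cast_mul]
  calc thetaDdotTerm q2 (q2 ^ a * U) (n - a)
      = (((n - a).negOnePow : ℤ) : 𝕜) * (q2 ^ ((n - a) * (n - a + 1)) *
          q2 ^ (a * (2 * (n - a) + 1))) * U ^ (2 * (n - a) + 1) := by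
        simp only [thetaDdotTerm, mul_zpow, ← zpow_mul]
        ring
    _ = ((n.negOnePow : ℤ) : 𝕜) * ((a.negOnePow : ℤ) : 𝕜) * (q2 ^ (-(a * a)) *
          q2 ^ (n * (n + 1))) * (U ^ (-(2 * a)) * U ^ (2 * n + 1)) := by rw [e1, e2, e3]
    _ = ((a.negOnePow : ℤ) : 𝕜) * q2 ^ (-(a * a)) * U ^ (-(2 * a)) * thetaDdotTerm q2 U n := by
        simp only [thetaDdotTerm]
        ring

/-- The successor relation `T(n+1) = -(q̈^{2n+2} Ü²) · T(n)` (`q̈, Ü ≠ 0`), used for convergence.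
[cite: MochizukiEtTh2009, Prop 1.4 p.21] -/
theorem thetaDdotTerm_succ {q2 U : 𝕜} (hq : q2 ≠ 0) (hU : U ≠ 0) (n : ℤ) :
    thetaDdotTerm q2 U (n + 1) = -(q2 ^ (2 * n + 2) * U ^ 2) * thetaDdotTerm q2 U n := by
  have e1 : q2 ^ ((n + 1) * (n + 1 + 1)) = q2 ^ (2 * n + 2) * q2 ^ (n * (n + 1)) := by
    rw [← zpow_add₀ hq]
    congr 1
    ring
  have e2 : U ^ (2 * (n + 1) + 1) = U ^ (2 : ℤ) * U ^ (2 * n + 1) := by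
    rw [← zpow_add₀ hU]
    congr 1
    ring
  simp only [thetaDdotTerm, Int.negOnePow_succ, Units.val_neg, Int.cast_neg, e1, e2, zpow_ofNat]
  ring

/-! ### Proposition 1.4 (ii): the three functional equations (PROVED) -/

/-- **Prop. 1.4 (ii), first equation**: `Θ̈(Ü) = -Θ̈(Ü⁻¹)`, here as `Θ̈(Ü⁻¹) = -Θ̈(Ü)`; a
re-indexing of the series, no convergence hypothesis needed. [cite: MochizukiEtTh2009, Prop 1.4 (ii) p.22] -/
theorem thetaDdot_inv (q2 U : 𝕜) : thetaDdot q2 U⁻¹ = -thetaDdot q2 U := by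
  unfold thetaDdot
  rw [← (Equiv.subLeft (-1 : ℤ)).tsum_eq]
  have h : ∀ n : ℤ, Equiv.subLeft (-1 : ℤ) n = -(n + 1) := fun n => by
    rw [Equiv.subLeft_apply]
    ring
  simp only [h, thetaDdotTerm_inv_neg_succ, tsum_neg]

/-- **Prop. 1.4 (ii), second equation**: `Θ̈(-Ü) = -Θ̈(Ü)`. [cite: MochizukiEtTh2009, Prop 1.4 (ii) p.22] -/
theorem thetaDdot_neg (q2 U : 𝕜) : thetaDdot q2 (-U) = -thetaDdot q2 U := by
  unfold thetaDdot
  simp only [thetaDdotTerm_neg, tsum_neg]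

/-- **Prop. 1.4 (ii), third equation**: `Θ̈(q_X^{a/2} Ü) = (-1)^a · q_X^{-a²/2} · Ü^{-2a} · Θ̈(Ü)`
for `a ∈ ℤ`, written with `q̈ = q_X^{1/2}`: `Θ̈(q̈^a Ü) = (-1)^a q̈^{-a²} Ü^{-2a} Θ̈(Ü)`
(`q̈ ≠ 0`, `Ü ≠ 0`; a re-indexing `n ↦ n - a`, no convergence hypothesis).
[cite: MochizukiEtTh2009, Prop 1.4 (ii) p.22] -/
theorem thetaDdot_zpow_mul {q2 U : 𝕜} (hq : q2 ≠ 0) (hU : U ≠ 0) (a : ℤ) :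
    thetaDdot q2 (q2 ^ a * U) =
      ((a.negOnePow : ℤ) : 𝕜) * q2 ^ (-(a * a)) * U ^ (-(2 * a)) * thetaDdot q2 U := by
  unfold thetaDdot
  rw [← (Equiv.subRight a).tsum_eq]
  simp only [Equiv.subRight_apply, thetaDdotTerm_shift hq hU, tsum_mul_left]

/-! ### The cusps are zeros: `Θ̈(±q̈^a) = 0` (PROVED; from the proof of Prop. 1.4 (i)) -/

variable [CharZero 𝕜]

/-- "A similar calculation shows that `Θ̈(±1) = 0`" (proof of Prop. 1.4, p. 22): `Θ̈(1) = 0`, since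
`Θ̈(1) = Θ̈(1⁻¹) = -Θ̈(1)` (characteristic `≠ 2`). [cite: MochizukiEtTh2009, Prop 1.4 (i) p.21] -/
theorem thetaDdot_one (q2 : 𝕜) : thetaDdot q2 1 = 0 := by
  have h := thetaDdot_inv q2 1
  rw [inv_one] at h
  exact CharZero.eq_neg_self_iff.mp h

/-- `Θ̈(-1) = 0` (proof of Prop. 1.4, p. 22). [cite: MochizukiEtTh2009, Prop 1.4 (i) p.21] -/
theorem thetaDdot_neg_one (q2 : 𝕜) : thetaDdot q2 (-1) = 0 := by
  rw [thetaDdot_neg, thetaDdot_one, neg_zero]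

/-- Every cusp `Ü = q̈^a` of `Ÿ` is a zero: `Θ̈(q̈^a) = 0` (`q̈ ≠ 0`, `a ∈ ℤ`) — the easy inclusion
of Prop. 1.4 (i) "the zeroes of `Θ̈` on `Ÿ` are precisely the cusps of `Ÿ`", from (ii).
[cite: MochizukiEtTh2009, Prop 1.4 (i) p.21] -/
theorem thetaDdot_zpow {q2 : 𝕜} (hq : q2 ≠ 0) (a : ℤ) : thetaDdot q2 (q2 ^ a) = 0 := by
  have h := thetaDdot_zpow_mul hq (one_ne_zero (α := 𝕜)) a
  rwa [mul_one, thetaDdot_one, mul_zero] at h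

/-- Every cusp `Ü = -q̈^a` of `Ÿ` is a zero: `Θ̈(-q̈^a) = 0`. [cite: MochizukiEtTh2009, Prop 1.4 (i) p.21] -/
theorem thetaDdot_neg_zpow {q2 : 𝕜} (hq : q2 ≠ 0) (a : ℤ) : thetaDdot q2 (-(q2 ^ a)) = 0 := by
  rw [thetaDdot_neg, thetaDdot_zpow hq, neg_zero]

end General

/-! ### Convergence (`‖q̈‖ < 1`): "`Θ̈ ∈ Γ(Ü, O_Ü)` … extends uniquely to a meromorphic function" -/

section Convergence

variable {𝕜 : Type*} [NormedField 𝕜]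

/-- The norm of the general term: `‖T(n)‖ = ‖q̈‖^{n(n+1)} ‖Ü‖^{2n+1}`. [cite: MochizukiEtTh2009, Prop 1.4 p.21] -/
theorem norm_thetaDdotTerm (q2 U : 𝕜) (n : ℤ) :
    ‖thetaDdotTerm q2 U n‖ = ‖q2‖ ^ (n * (n + 1)) * ‖U‖ ^ (2 * n + 1) := by
  simp only [thetaDdotTerm, norm_mul, norm_zpow, Int.cast_negOnePow, norm_neg, norm_one, one_zpow,
    one_mul]

/-- Convergence of the half-series `n ≥ 0` for `‖q̈‖ < 1`, `q̈ ≠ 0`, `Ü ≠ 0` (ratio test: the ratio of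
consecutive terms has norm `‖q̈‖^{2n+2}‖Ü‖² → 0`). [cite: MochizukiEtTh2009, Prop 1.4 p.21] -/
theorem summable_thetaDdotTerm_nat [CompleteSpace 𝕜] {q2 U : 𝕜} (hq : ‖q2‖ < 1) (hq0 : q2 ≠ 0)
    (hU : U ≠ 0) : Summable fun n : ℕ => thetaDdotTerm q2 U n := by
  have hne : ∀ n : ℕ, thetaDdotTerm q2 U n ≠ 0 := fun n => by
    rw [← norm_pos_iff, norm_thetaDdotTerm]
    exact mul_pos (zpow_pos (norm_pos_iff.mpr hq0) _) (zpow_pos (norm_pos_iff.mpr hU) _)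
  refine summable_of_ratio_test_tendsto_lt_one zero_lt_one (Eventually.of_forall hne) ?_
  have hratio : ∀ n : ℕ, ‖thetaDdotTerm q2 U (↑(n + 1))‖ / ‖thetaDdotTerm q2 U n‖ =
      (‖q2‖ ^ 2) ^ (n + 1) * ‖U‖ ^ 2 := fun n => by
    rw [Nat.cast_succ, thetaDdotTerm_succ hq0 hU, norm_mul, mul_div_assoc,
      div_self (norm_ne_zero_iff.mpr (hne n)), mul_one, norm_neg, norm_mul, norm_zpow, norm_pow]
    rw [show (2 : ℤ) * (n : ℤ) + 2 = ((2 * (n + 1) : ℕ) : ℤ) by push_cast; ring, zpow_natCast,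
      pow_mul]
  simp only [hratio]
  have h0 : Tendsto (fun n : ℕ => (‖q2‖ ^ 2) ^ (n + 1)) atTop (𝓝 0) :=
    (tendsto_add_atTop_iff_nat 1).mpr
      (tendsto_pow_atTop_nhds_zero_of_lt_one (sq_nonneg _) (by nlinarith [norm_nonneg q2]))
  simpa using h0.mul_const (‖U‖ ^ 2)

/-- **Convergence**: for `‖q̈‖ < 1` in a complete normed field the series `Σ_{n ∈ ℤ} (-1)^n q̈^{n(n+1)} Ü^{2n+1}`
is summable for every `Ü` — the point-level content of "`Θ̈ ∈ Γ(Ü, O_Ü)`, so `Θ̈` extends uniquely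
to a meromorphic function on `Ÿ`" (Prop. 1.4; the `n < 0` half is the `n ≥ 0` half for `Ü⁻¹`).
[cite: MochizukiEtTh2009, Prop 1.4 p.21] -/
theorem summable_thetaDdotTerm [CompleteSpace 𝕜] {q2 : 𝕜} (hq : ‖q2‖ < 1) (U : 𝕜) :
    Summable (thetaDdotTerm q2 U) := by
  by_cases hU : U = 0
  · have : thetaDdotTerm q2 U = 0 := by
      funext n
      have h : (2 : ℤ) * n + 1 ≠ 0 := by omega
      simp [thetaDdotTerm, hU, zero_zpow _ h]
    rw [this]
    exact summable_zero
  by_cases hq0 : q2 = 0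
  · refine summable_of_ne_finset_zero (s := {0, -1}) fun n hn => ?_
    have h : n * (n + 1) ≠ 0 := by
      simp only [Finset.mem_insert, Finset.mem_singleton, not_or] at hn
      exact mul_ne_zero hn.1 (by omega)
    simp [thetaDdotTerm, hq0, zero_zpow _ h]
  refine Summable.of_nat_of_neg_add_one (summable_thetaDdotTerm_nat hq hq0 hU) ?_
  have h : ∀ n : ℕ, thetaDdotTerm q2 U (-((n : ℤ) + 1)) = -thetaDdotTerm q2 U⁻¹ n := fun n => by
    rw [← thetaDdotTerm_inv_neg_succ q2 U⁻¹ n, inv_inv]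
  simp only [h]
  exact (summable_thetaDdotTerm_nat hq hq0 (inv_ne_zero hU)).neg

/-- With convergence, `Θ̈(Ü)` is the SUM of its series (not merely a `tsum` by convention).
[cite: MochizukiEtTh2009, Prop 1.4 p.21] -/
theorem hasSum_thetaDdot [CompleteSpace 𝕜] {q2 : 𝕜} (hq : ‖q2‖ < 1) (U : 𝕜) :
    HasSum (thetaDdotTerm q2 U) (thetaDdot q2 U) :=
  (summable_thetaDdotTerm hq U).hasSum

end Convergence

/-! ### Over `ℂ`: `Θ̈` is Jacobi's odd theta function; the zero locus of Prop. 1.4 (i) (PROVED) -/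

section Complex

open _root_.Complex _root_.Real

/-- Termwise comparison with Mathlib: for `q̈ = e^{πiτ}`, `Ü = e^{πiz}`,
`(-1)^n q̈^{n(n+1)} Ü^{2n+1} = e^{πiz} · exp(2πi n (z + (1+τ)/2) + πi n² τ)`.
[cite: MochizukiEtTh2009, Prop 1.4 p.21] -/
theorem thetaDdotTerm_eq_jacobiTheta₂_term (z τ : ℂ) (n : ℤ) :
    thetaDdotTerm (cexp (π * I * τ)) (cexp (π * I * z)) n =
      cexp (π * I * z) * jacobiTheta₂_term n (z + (1 + τ) / 2) τ := by
  have hsign : (((n.negOnePow : ℤ) : ℂ)) = cexp (π * I) ^ n := by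
    rw [Int.cast_negOnePow, Complex.exp_pi_mul_I]
  rw [thetaDdotTerm, hsign, jacobiTheta₂_term, ← Complex.exp_int_mul, ← Complex.exp_int_mul,
    ← Complex.exp_int_mul, ← Complex.exp_add, ← Complex.exp_add, ← Complex.exp_add]
  congr 1
  push_cast
  ring

/-- **`Θ̈` is Jacobi's odd theta function**: for `τ, z ∈ ℂ`, with `q̈ = e^{πiτ}` and `Ü = e^{πiz}`,
`Θ̈(Ü) = e^{πiz} · ϑ(z + (1+τ)/2, τ)` in Mathlib's normalisation `ϑ = jacobiTheta₂`
("as is well-known from the theory of the Tate curve [cf., e.g., [Mumf], pp. 306–307]").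
[cite: MochizukiEtTh2009, Prop 1.4 p.21] -/
theorem thetaDdot_eq_jacobiTheta₂ (z τ : ℂ) :
    thetaDdot (cexp (π * I * τ)) (cexp (π * I * z)) =
      cexp (π * I * z) * jacobiTheta₂ (z + (1 + τ) / 2) τ := by
  unfold thetaDdot jacobiTheta₂
  simp only [thetaDdotTerm_eq_jacobiTheta₂_term, tsum_mul_left]

/-- Every nonzero complex number is `e^{πiz}` for `z = log w/(πi)`. [folklore] -/
private theorem cexp_pi_I_mul_log (w : ℂ) (hw : w ≠ 0) :
    cexp (π * I * (Complex.log w * (-I) / π)) = w := by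
  have hπ : (π : ℂ) ≠ 0 := ofReal_ne_zero.mpr Real.pi_ne_zero
  rw [show (π : ℂ) * I * (Complex.log w * -I / π) = Complex.log w * (-(I * I)) * (π / π) by ring,
    Complex.I_mul_I, neg_neg, mul_one, div_self hπ, mul_one, Complex.exp_log hw]

/-- Every nonzero complex number is `e^{πiz}` for some `z`. [folklore] -/
private theorem exists_cexp_pi_I_mul_eq {w : ℂ} (hw : w ≠ 0) : ∃ z : ℂ, cexp (π * I * z) = w :=
  ⟨_, cexp_pi_I_mul_log w hw⟩

/-- A point `τ` of the upper half-plane with `e^{πiτ} = q̈`, for `0 < ‖q̈‖ < 1` (as in the tree's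
`JacobiTripleProduct`, where this is private). [folklore] -/
private theorem exists_cexp_eq_of_norm_lt_one {q : ℂ} (hq : ‖q‖ < 1) (hq0 : q ≠ 0) :
    ∃ τ : ℂ, 0 < τ.im ∧ cexp (π * I * τ) = q := by
  refine ⟨Complex.log q * (-I) / π, ?_, cexp_pi_I_mul_log q hq0⟩
  rw [Complex.div_ofReal_im, Complex.mul_im, Complex.neg_re, Complex.I_re, Complex.neg_im,
    Complex.I_im, Complex.log_re]
  have hlog : Real.log ‖q‖ < 0 := Real.log_neg (norm_pos_iff.mpr hq0) hq
  have : 0 < -Real.log ‖q‖ / π := div_pos (neg_pos.mpr hlog) Real.pi_pos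
  simpa using this

/-- `e^{πi(m + nτ)} = (-1)^m (e^{πiτ})^n`. [folklore] -/
private theorem cexp_pi_I_mul_int_add_int_mul (τ : ℂ) (m n : ℤ) :
    cexp (π * I * (m + n * τ)) = (-1) ^ m * cexp (π * I * τ) ^ n := by
  rw [← Complex.exp_pi_mul_I, ← Complex.exp_int_mul, ← Complex.exp_int_mul, ← Complex.exp_add]
  congr 1
  ring

/-- **Prop. 1.4 (i), zero locus, over `ℂ`** (PROVED): for `0 < ‖q̈‖ < 1` and `Ü ≠ 0`,
`Θ̈(Ü) = 0 ↔ Ü = ±q̈^a` for some `a ∈ ℤ` — "the zeroes of `Θ̈` on `Ÿ` are precisely the cusps of `Ÿ`"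
read on `ℂ`-points (`Ü² = U`, cusps `U = q_X^a`). Proof: `Θ̈ = e^{πiz} ϑ(z + (1+τ)/2, τ)` and the
tree's `jacobiTheta₂_eq_zero_iff` (zeros of `ϑ(·, τ)` = `(1+τ)/2 + ℤ + ℤτ`).
[cite: MochizukiEtTh2009, Prop 1.4 (i) p.21] -/
theorem thetaDdot_eq_zero_iff_complex {q2 U : ℂ} (hq : ‖q2‖ < 1) (hq0 : q2 ≠ 0) (hU : U ≠ 0) :
    thetaDdot q2 U = 0 ↔ ∃ a : ℤ, U = q2 ^ a ∨ U = -(q2 ^ a) := by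
  obtain ⟨τ, hτ, rfl⟩ := exists_cexp_eq_of_norm_lt_one hq hq0
  obtain ⟨z, rfl⟩ := exists_cexp_pi_I_mul_eq hU
  rw [thetaDdot_eq_jacobiTheta₂, mul_eq_zero, or_iff_right (Complex.exp_ne_zero _),
    Literature.Analysis.SpecialFunctions.jacobiTheta₂_eq_zero_iff hτ]
  constructor
  · rintro ⟨m, n, h⟩
    have hz : z = m + n * τ := by linear_combination h
    refine ⟨n, ?_⟩
    rw [hz, cexp_pi_I_mul_int_add_int_mul]
    rcases Int.even_or_odd m with hm | hm
    · left
      rw [hm.neg_one_zpow, one_mul]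
    · right
      rw [hm.neg_one_zpow, neg_one_mul]
  · rintro ⟨a, h⟩
    -- `Ü = ±q̈^a = e^{πi(m₀ + aτ)}` with `m₀ ∈ {0, 1}`; compare exponents modulo `2πiℤ`.
    have key : ∃ m₀ : ℤ, cexp (π * I * z) = cexp (π * I * (m₀ + a * τ)) := by
      rcases h with h | h
      · exact ⟨0, by rw [h, cexp_pi_I_mul_int_add_int_mul]; simp⟩
      · exact ⟨1, by rw [h, cexp_pi_I_mul_int_add_int_mul]; simp⟩
    obtain ⟨m₀, hm₀⟩ := key
    obtain ⟨k, hk⟩ := Complex.exp_eq_exp_iff_exists_int.mp hm₀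
    have hπ : (π : ℂ) * I ≠ 0 := mul_ne_zero (ofReal_ne_zero.mpr Real.pi_ne_zero) I_ne_zero
    have hz : z = (m₀ + 2 * k : ℤ) + a * τ := by
      have := mul_left_cancel₀ hπ (by linear_combination hk : (π : ℂ) * I * z =
        π * I * ((m₀ + a * τ) + 2 * k))
      rw [this]
      push_cast
      ring
    exact ⟨m₀ + 2 * k, a, by rw [hz]; ring⟩

end Complex

/-! ### Proposition 1.4 (i) over nonarchimedean fields: NAMED FACTS (not proved here) -/

/-- **Prop. 1.4 (i), zero locus (nonarchimedean; named fact, NOT proved here)**: for every field `L`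
complete with respect to a nontrivial nonarchimedean absolute value and every `q̈ ∈ L` with
`0 < ‖q̈‖ < 1`, the zeros of `Ü ↦ Θ̈(Ü)` on `L^×` are exactly `Ü = ±q̈^a`, `a ∈ ℤ` — "the zeroes of
`Θ̈` on `Ÿ` are precisely the cusps of `Ÿ`" at the level of `L`-valued points of the generic fibre
(`L ⊇ K̈` finite, `Ÿ(L) ∖ cusps ↔ L^×` via `Ü`). Classical ([Mumf] pp. 306–307, via the Jacobi triple
product, which the tree proves over `ℂ` only: see `thetaDdot_eq_zero_iff_complex` for the complex
case, PROVED). [cite: MochizukiEtTh2009, Prop 1.4 (i) p.21] -/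
def ThetaDdotZeroLocus : Prop :=
  ∀ (L : Type) [NontriviallyNormedField L] [CompleteSpace L] [IsUltrametricDist L] (q2 : L),
    0 < ‖q2‖ → ‖q2‖ < 1 → ∀ U : L, U ≠ 0 →
      (thetaDdot q2 U = 0 ↔ ∃ a : ℤ, U = q2 ^ a ∨ U = -(q2 ^ a))

/-- **Prop. 1.4 (i), "each zero has multiplicity 1" (nonarchimedean; named fact, NOT proved here)**:
in the setting of `ThetaDdotZeroLocus`, `Θ̈` has nonvanishing derivative at each of its zeros
`Ü = ±q̈^a`. [cite: MochizukiEtTh2009, Prop 1.4 (i) p.21] -/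
def ThetaDdotSimpleZeros : Prop :=
  ∀ (L : Type) [NontriviallyNormedField L] [CompleteSpace L] [IsUltrametricDist L] (q2 : L),
    0 < ‖q2‖ → ‖q2‖ < 1 → ∀ a : ℤ,
      deriv (thetaDdot q2) (q2 ^ a) ≠ 0 ∧ deriv (thetaDdot q2) (-(q2 ^ a)) ≠ 0

/-- **Prop. 1.4 (i), "each zero has multiplicity 1" — CORRECTED STATEMENT** (named fact) over fields
with `2 ≠ 0` (the paper's `K̈ ⊇ ℚ_p`). The unrestricted `ThetaDdotSimpleZeros` above is FALSE AS TYPED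
(char. `2`: the cusps `±1` coincide, the zero at `1` is double) — refuted in the tree by abc-iut-L2-t6
(`not_thetaDdotSimpleZeros`, witness `𝔽₂((X))`), who proves this version and `ThetaDdotZeroLocus`;
do not use the unprimed fact. (Errata A2-F1/F2 of referee PASS-A2: `K̈ := K₂` is pp. 13, 17;
`thetaDdot_one` assumes `CharZero`.) [cite: MochizukiEtTh2009, Prop 1.4 (i) p.21] -/
def ThetaDdotSimpleZeros' : Prop :=
  ∀ (L : Type) [NontriviallyNormedField L] [CompleteSpace L] [IsUltrametricDist L] (q2 : L),
    (2 : L) ≠ 0 → 0 < ‖q2‖ → ‖q2‖ < 1 → ∀ a : ℤ,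
      deriv (thetaDdot q2) (q2 ^ a) ≠ 0 ∧ deriv (thetaDdot q2) (-(q2 ^ a)) ≠ 0

end Literature.AnabelianGeometry.EtaleTheta
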